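import Summits.HubbardSuperconductivity.HubbardSuperconductivity.Theorems.AnisotropyChordTransferFibre3KT2bStrip

/-!
# Route `AnisotropyChord` / H0 rotor rung, PartN41-E §1 PROVED: the WINDOW-SHELL CANCELLATION `ShellWinSharp(N)` — the sharp
drop-in for `RowC.shellWin_le_ZwN`

Theory-1 g23's PartN41-E §1 (port `…Fibre3KT2bStrip`, director RULING D4′ plan of record): on the six window-shell sites
`b ∈ {−x̂, ±ŷ, 2x̂, x̂ ± ŷ}` the regrouped shell form `ShellRow.c0_shell_PQRT` becomes, after the 22 window-site substitutions
(`RowC.site_values`), LITERALLY the cancelled cubic `Pxx` (`b = 2x̂, −x̂`) resp. `Pxy` (`b = ±ŷ, x̂ ± ŷ`) in the window values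
`(a, u₁₀, u₁₁, u₂₀, u₂₁, u₃₀)` — the hard-core slot `f(x̂)` now sits INSIDE the polynomial and the two `O(c_s f²)` terms of the crude
bound `RowC.c0_abs_le` cancel to `f ξ²` / `f ζ²` (`c0_win_*_eq`, ★ `c0WinXXForm_holds`, `c0WinXYForm_holds`, `c0WinOrbits_holds`);
the two pure-arithmetic slot lemmas ★ `pxxSharpLe_holds` / `pxySharpLe_holds` are theory-1's own proofs (PartN41EProofs.lean sha16
`a314cb9cfe2a726e`, Mathlib-only) pasted verbatim; with `RowC.site_numbers` they give ★★ `shellWinSharp_holds : ShellWinSharp L`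
and ★★ `shellWinSharpN_holds : ShellWinSharpN L` — `Σ_{b ∈ shellWin} C0(x̂,b)² ≤ ZwS(c_s, a) = 2·Bxx² + 4·Bxy²`, the hypothesis `hZ` of
the row-C cell soundness with `ZwSN` in place of `ZwN` (which it undercuts by ×180 … ×190 000 on the strip).
Prover seat `hubbard-h0-rotor-p1` g29 (route lead); helper for piece A = stmt-HubbardSuperconductivity-23918 of rung 19089
(`--supports`, helper class).  Nothing here proves superconductivity in the Hubbard model; family-C inputs of ONE conditional
reduction; the rotor TARGET as originally worded stays FALSE (g15 verdict).  Tree imports only; no sorry.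
-/

set_option linter.dupNamespace false
set_option autoImplicit false

noncomputable section

open Finset
open scoped BigOperators

namespace Summit.HubbardSuperconductivity.HubbardSuperconductivity.Theorems.AnisotropyChord.Transfer.Fibre3

namespace N41E

/-! ## The two slot lemmas (theory-1 g23, PartN41EProofs.lean, verbatim) -/

/-- `0 ≤ x ≤ X`, `0 ≤ y ≤ Y` ⇒ `xy ≤ XY`. [folklore] -/
theorem mul2_le {x y X Y : ℝ} (hx : 0 ≤ x) (hy : 0 ≤ y) (h1 : x ≤ X) (h2 : y ≤ Y) : x * y ≤ X * Y :=
  mul_le_mul h1 h2 hy (hx.trans h1)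

/-- ★ `PxxSharpLe` holds. [folklore] -/
theorem pxxSharpLe_holds : PxxSharpLe := by
  intro a cs u10 u11 u20 u21 u30 ha hcs h10l h10u h11l h11u h20l h20u h21l h21u h30l h30u
  -- window differences (all nonnegative) and their enclosures
  have hf0 : 0 ≤ a + u10 := by linarith
  have hξl : cs * 0.1123 ≤ u20 - u10 := by linarith
  have hξu : u20 - u10 ≤ cs * 0.11442 := by linarith
  have hξ0 : 0 ≤ u20 - u10 := by linarith
  have hζl : cs * 0.0673 ≤ u11 - u10 := by linarith
  have hζu : u11 - u10 ≤ cs * 0.06933 := by linarith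
  have hζ0 : 0 ≤ u11 - u10 := by linarith
  have hdl : cs * 0.06288 ≤ u30 - u20 := by linarith
  have hdu : u30 - u20 ≤ cs * 0.0710 := by linarith
  have hd0 : 0 ≤ u30 - u20 := by linarith
  have hel : cs * 0.021218 ≤ u21 - u20 := by linarith
  have heu : u21 - u20 ≤ cs * 0.02532 := by linarith
  have he0 : 0 ≤ u21 - u20 := by linarith
  have hF0 : 0 ≤ a + u20 := by linarith
  -- the four monomials of `−Pxx = f ξ d₃₀ + 2 f ζ d₂₁ + (a+u₂₀) ζ² − f ξ²`
  have T1u : (a + u10) * ((u20 - u10) * (u30 - u20)) ≤ (a + u10) * (cs * 0.11442 * (cs * 0.0710)) :=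
    mul_le_mul_of_nonneg_left (mul2_le hξ0 hd0 hξu hdu) hf0
  have T1l : (a + u10) * (cs * 0.1123 * (cs * 0.06288)) ≤ (a + u10) * ((u20 - u10) * (u30 - u20)) :=
    mul_le_mul_of_nonneg_left (mul2_le (by positivity) (by positivity) hξl hdl) hf0
  have T2u : (a + u10) * ((u11 - u10) * (u21 - u20)) ≤ (a + u10) * (cs * 0.06933 * (cs * 0.02532)) :=
    mul_le_mul_of_nonneg_left (mul2_le hζ0 he0 hζu heu) hf0
  have T2l : (a + u10) * (cs * 0.0673 * (cs * 0.021218)) ≤ (a + u10) * ((u11 - u10) * (u21 - u20)) :=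
    mul_le_mul_of_nonneg_left (mul2_le (by positivity) (by positivity) hζl hel) hf0
  have T3u : (a + u20) * ((u11 - u10) * (u11 - u10)) ≤ (a + cs * 0.3644) * (cs * 0.06933 * (cs * 0.06933)) :=
    mul_le_mul (by linarith) (mul2_le hζ0 hζ0 hζu hζu) (mul_nonneg hζ0 hζ0) (by positivity)
  have T3l : (a + cs * 0.3623) * (cs * 0.0673 * (cs * 0.0673)) ≤ (a + u20) * ((u11 - u10) * (u11 - u10)) :=
    mul_le_mul (by linarith) (mul2_le (by positivity) (by positivity) hζl hζl) (by positivity) hF0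
  have T4u : (a + u10) * ((u20 - u10) * (u20 - u10)) ≤ (a + u10) * (cs * 0.11442 * (cs * 0.11442)) :=
    mul_le_mul_of_nonneg_left (mul2_le hξ0 hξ0 hξu hξu) hf0
  have T4l : (a + u10) * (cs * 0.1123 * (cs * 0.1123)) ≤ (a + u10) * ((u20 - u10) * (u20 - u10)) :=
    mul_le_mul_of_nonneg_left (mul2_le (by positivity) (by positivity) hξl hξl) hf0
  have e : -(Pxx a u10 u11 u20 u21 u30)
      = (a + u10) * ((u20 - u10) * (u30 - u20)) + 2 * ((a + u10) * ((u11 - u10) * (u21 - u20)))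
        + (a + u20) * ((u11 - u10) * (u11 - u10)) - (a + u10) * ((u20 - u10) * (u20 - u10)) := by
    unfold Pxx; ring
  have hcs2 : 0 ≤ cs ^ 2 := sq_nonneg cs
  have hu10 : 0 ≤ u10 := by linarith
  have k1 : 0 ≤ u10 * cs ^ 2 := mul_nonneg hu10 hcs2
  have k2 : 0 ≤ a * cs ^ 2 := mul_nonneg ha hcs2
  have k3 : 0 ≤ cs ^ 3 := pow_nonneg hcs 3
  have k4 : 0 ≤ (cs * 0.25 - u10) * cs ^ 2 := mul_nonneg (by linarith) hcs2
  have up : -(Pxx a u10 u11 u20 u21 u30) ≤ BxxN cs a := by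
    rw [e]; unfold BxxN; linarith [T1u, T2u, T3u, T4l, k1, k2, k3]
  have lo : 0 ≤ -(Pxx a u10 u11 u20 u21 u30) := by
    rw [e]; linarith [T1l, T2l, T3l, T4u, k1, k2, k3, k4]
  rw [abs_of_nonpos (by linarith)]
  exact up

/-- ★ `PxySharpLe` holds. [folklore] -/
theorem pxySharpLe_holds : PxySharpLe := by
  intro a cs u10 u11 u20 u21 ha hcs h10l h10u h11l h11u h20l h20u h21l h21u
  have hf0 : 0 ≤ a + u10 := by linarith
  have hξl : cs * 0.1123 ≤ u20 - u10 := by linarith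
  have hξu : u20 - u10 ≤ cs * 0.11442 := by linarith
  have hξ0 : 0 ≤ u20 - u10 := by linarith
  have hζl : cs * 0.0673 ≤ u11 - u10 := by linarith
  have hζu : u11 - u10 ≤ cs * 0.06933 := by linarith
  have hζ0 : 0 ≤ u11 - u10 := by linarith
  have hsl : cs * 0.1796 ≤ (u20 - u10) + (u11 - u10) := by linarith
  have hsu : (u20 - u10) + (u11 - u10) ≤ cs * 0.18375 := by linarith
  have hs0 : 0 ≤ (u20 - u10) + (u11 - u10) := by linarith
  have hdl : cs * 0.066308 ≤ u21 - u11 := by linarith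
  have hdu : u21 - u11 ≤ cs * 0.07032 := by linarith
  have hd0 : 0 ≤ u21 - u11 := by linarith
  have hF0 : 0 ≤ a + u11 := by linarith
  -- `−Pxy = f (ξ+ζ) d′₂₁ + (a+u₁₁) ξ ζ − 2 f ζ²`
  have S1u : (a + u10) * (((u20 - u10) + (u11 - u10)) * (u21 - u11)) ≤ (a + u10) * (cs * 0.18375 * (cs * 0.07032)) :=
    mul_le_mul_of_nonneg_left (mul2_le hs0 hd0 hsu hdu) hf0
  have S1l : (a + u10) * (cs * 0.1796 * (cs * 0.066308)) ≤ (a + u10) * (((u20 - u10) + (u11 - u10)) * (u21 - u11)) :=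
    mul_le_mul_of_nonneg_left (mul2_le (by positivity) (by positivity) hsl hdl) hf0
  have S2u : (a + u11) * ((u20 - u10) * (u11 - u10)) ≤ (a + cs * 0.31931) * (cs * 0.11442 * (cs * 0.06933)) :=
    mul_le_mul (by linarith) (mul2_le hξ0 hζ0 hξu hζu) (mul_nonneg hξ0 hζ0) (by positivity)
  have S2l : (a + cs * 0.3173) * (cs * 0.1123 * (cs * 0.0673)) ≤ (a + u11) * ((u20 - u10) * (u11 - u10)) :=
    mul_le_mul (by linarith) (mul2_le (by positivity) (by positivity) hξl hζl) (by positivity) hF0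
  have S3u : (a + u10) * ((u11 - u10) * (u11 - u10)) ≤ (a + u10) * (cs * 0.06933 * (cs * 0.06933)) :=
    mul_le_mul_of_nonneg_left (mul2_le hζ0 hζ0 hζu hζu) hf0
  have S3l : (a + u10) * (cs * 0.0673 * (cs * 0.0673)) ≤ (a + u10) * ((u11 - u10) * (u11 - u10)) :=
    mul_le_mul_of_nonneg_left (mul2_le (by positivity) (by positivity) hζl hζl) hf0
  have e : -(Pxy a u10 u11 u20 u21)
      = (a + u10) * (((u20 - u10) + (u11 - u10)) * (u21 - u11)) + (a + u11) * ((u20 - u10) * (u11 - u10))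
        - 2 * ((a + u10) * ((u11 - u10) * (u11 - u10))) := by
    unfold Pxy; ring
  have hcs2 : 0 ≤ cs ^ 2 := sq_nonneg cs
  have hu10 : 0 ≤ u10 := by linarith
  have k1 : 0 ≤ u10 * cs ^ 2 := mul_nonneg hu10 hcs2
  have k2 : 0 ≤ a * cs ^ 2 := mul_nonneg ha hcs2
  have k3 : 0 ≤ cs ^ 3 := pow_nonneg hcs 3
  have k4 : 0 ≤ (cs * 0.25 - u10) * cs ^ 2 := mul_nonneg (by linarith) hcs2
  have up : -(Pxy a u10 u11 u20 u21) ≤ BxyN cs a := by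
    rw [e]; unfold BxyN; linarith [S1u, S2u, S3l, k1, k2, k3, k4]
  have lo : 0 ≤ -(Pxy a u10 u11 u20 u21) := by
    rw [e]; linarith [S1l, S2l, S3u, k1, k2, k3, k4]
  rw [abs_of_nonpos (by linarith)]
  exact up

end N41E

namespace RowC

variable (L : ℕ) [NeZero L]

/-! ## The six window sites in cancelled form -/

/-- the window configuration `b = 2x̂` in cancelled form: `C0(x̂, b) = Pxx(a, u₁₀, u₁₁, u₂₀, u₂₁, u₃₀)`
(`c0_shell_PQRT` + `site_values` + `ring`). [folklore] -/
theorem c0_win_xx_eq (hL : 128 ≤ L) {Δ lam2 : ℝ} {f : Tor L → ℝ} (hΔ0 : 0 ≤ Δ) (hΔ1 : Δ < 1)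
    (hf : IsGroundTwoMagnon L Δ lam2 f) :
    C0fn L Δ lam2 f (ex L, ex L + ex L) = N41E.Pxx (Δ * f (K1 L)) (cS L Δ lam2 f * aKer L lam2 (B1.toTor L ((1 : ℤ), (0 : ℤ)))) (cS L Δ lam2 f * aKer L lam2 (B1.toTor L ((1 : ℤ), (1 : ℤ)))) (cS L Δ lam2 f * aKer L lam2 (B1.toTor L ((2 : ℤ), (0 : ℤ)))) (cS L Δ lam2 f * aKer L lam2 (B1.toTor L ((2 : ℤ), (1 : ℤ)))) (cS L Δ lam2 f * aKer L lam2 (B1.toTor L ((3 : ℤ), (0 : ℤ)))) := by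
  have hL2 : 2 ≤ L := by omega
  have hL3 : 3 ≤ L := by omega
  obtain ⟨hx, hy, hK⟩ := ex_ey_toTor L
  have hnd := ShellRow.nn_distinct L hL3
  have hex0 : ex L ≠ 0 := hnd.1
  have hey0 : ey L ≠ 0 := by
    rw [← hy]; exact toTor_ne_zero_snd L one_ne_zero (by simp only [abs_one]; exact_mod_cast (show 1 < L by omega))
  have hxmy0 : ex L - ey L ≠ 0 := by
    have e : ex L - ey L = B1.toTor L ((1 : ℤ), (-1 : ℤ)) := by unfold B1.toTor ex ey; ext <;> simp
    rw [e]
    exact toTor_ne_zero_snd L (by norm_num) (by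
      simp only [abs_neg, abs_one]; exact_mod_cast (show 1 < L by omega))
  obtain ⟨v0, v1, v2, v3, v4, v5, v6, v7, v8, v9, v10, v11, v12, v13, v14, v15, v16, v17, v18, v19, v20, v21, v00⟩ :=
    site_values L hL hΔ0 hΔ1 hf
  have hC := ShellRow.c0_shell_PQRT L hL3 hf.1 hf.2.1 (ground_mirror L hL2 hf) (ex L + ex L) (two_ex_ne_zero L hL3) (fun h => hex0 (by simpa using h))
  rw [hC]
  unfold Dgrad xiW zetaW N41E.Pxx
  norm_num only [← hx, ← hy, ← B1.toTor_add, ← B1.toTor_neg, ← toTor_sub, Prod.neg_mk, Prod.mk_add_mk, Prod.mk_sub_mk]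
  norm_num only [v0, v1, v2, v3, v4, v5, v6, v7, v8, v9, v10, v11, v12, v13, v14, v15, v16, v17, v18, v19, v20, v21, v00]
  ring

/-- the window configuration `b = −x̂` in cancelled form: `C0(x̂, b) = Pxx(a, u₁₀, u₁₁, u₂₀, u₂₁, u₃₀)`
(`c0_shell_PQRT` + `site_values` + `ring`). [folklore] -/
theorem c0_win_negx_eq (hL : 128 ≤ L) {Δ lam2 : ℝ} {f : Tor L → ℝ} (hΔ0 : 0 ≤ Δ) (hΔ1 : Δ < 1)
    (hf : IsGroundTwoMagnon L Δ lam2 f) :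
    C0fn L Δ lam2 f (ex L, -ex L) = N41E.Pxx (Δ * f (K1 L)) (cS L Δ lam2 f * aKer L lam2 (B1.toTor L ((1 : ℤ), (0 : ℤ)))) (cS L Δ lam2 f * aKer L lam2 (B1.toTor L ((1 : ℤ), (1 : ℤ)))) (cS L Δ lam2 f * aKer L lam2 (B1.toTor L ((2 : ℤ), (0 : ℤ)))) (cS L Δ lam2 f * aKer L lam2 (B1.toTor L ((2 : ℤ), (1 : ℤ)))) (cS L Δ lam2 f * aKer L lam2 (B1.toTor L ((3 : ℤ), (0 : ℤ)))) := by
  have hL2 : 2 ≤ L := by omega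
  have hL3 : 3 ≤ L := by omega
  obtain ⟨hx, hy, hK⟩ := ex_ey_toTor L
  have hnd := ShellRow.nn_distinct L hL3
  have hex0 : ex L ≠ 0 := hnd.1
  have hey0 : ey L ≠ 0 := by
    rw [← hy]; exact toTor_ne_zero_snd L one_ne_zero (by simp only [abs_one]; exact_mod_cast (show 1 < L by omega))
  have hxmy0 : ex L - ey L ≠ 0 := by
    have e : ex L - ey L = B1.toTor L ((1 : ℤ), (-1 : ℤ)) := by unfold B1.toTor ex ey; ext <;> simp
    rw [e]
    exact toTor_ne_zero_snd L (by norm_num) (by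
      simp only [abs_neg, abs_one]; exact_mod_cast (show 1 < L by omega))
  obtain ⟨v0, v1, v2, v3, v4, v5, v6, v7, v8, v9, v10, v11, v12, v13, v14, v15, v16, v17, v18, v19, v20, v21, v00⟩ :=
    site_values L hL hΔ0 hΔ1 hf
  have hC := ShellRow.c0_shell_PQRT L hL3 hf.1 hf.2.1 (ground_mirror L hL2 hf) (-ex L) (neg_ne_zero.mpr hex0) hnd.2.1
  rw [hC]
  unfold Dgrad xiW zetaW N41E.Pxx
  norm_num only [← hx, ← hy, ← B1.toTor_add, ← B1.toTor_neg, ← toTor_sub, Prod.neg_mk, Prod.mk_add_mk, Prod.mk_sub_mk]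
  norm_num only [v0, v1, v2, v3, v4, v5, v6, v7, v8, v9, v10, v11, v12, v13, v14, v15, v16, v17, v18, v19, v20, v21, v00]
  ring

/-- the window configuration `b = x̂+ŷ` in cancelled form: `C0(x̂, b) = Pxy(a, u₁₀, u₁₁, u₂₀, u₂₁)`
(`c0_shell_PQRT` + `site_values` + `ring`). [folklore] -/
theorem c0_win_xy_eq (hL : 128 ≤ L) {Δ lam2 : ℝ} {f : Tor L → ℝ} (hΔ0 : 0 ≤ Δ) (hΔ1 : Δ < 1)
    (hf : IsGroundTwoMagnon L Δ lam2 f) :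
    C0fn L Δ lam2 f (ex L, ex L + ey L) = N41E.Pxy (Δ * f (K1 L)) (cS L Δ lam2 f * aKer L lam2 (B1.toTor L ((1 : ℤ), (0 : ℤ)))) (cS L Δ lam2 f * aKer L lam2 (B1.toTor L ((1 : ℤ), (1 : ℤ)))) (cS L Δ lam2 f * aKer L lam2 (B1.toTor L ((2 : ℤ), (0 : ℤ)))) (cS L Δ lam2 f * aKer L lam2 (B1.toTor L ((2 : ℤ), (1 : ℤ)))) := by
  have hL2 : 2 ≤ L := by omega
  have hL3 : 3 ≤ L := by omega
  obtain ⟨hx, hy, hK⟩ := ex_ey_toTor L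
  have hnd := ShellRow.nn_distinct L hL3
  have hex0 : ex L ≠ 0 := hnd.1
  have hey0 : ey L ≠ 0 := by
    rw [← hy]; exact toTor_ne_zero_snd L one_ne_zero (by simp only [abs_one]; exact_mod_cast (show 1 < L by omega))
  have hxmy0 : ex L - ey L ≠ 0 := by
    have e : ex L - ey L = B1.toTor L ((1 : ℤ), (-1 : ℤ)) := by unfold B1.toTor ex ey; ext <;> simp
    rw [e]
    exact toTor_ne_zero_snd L (by norm_num) (by
      simp only [abs_neg, abs_one]; exact_mod_cast (show 1 < L by omega))
  obtain ⟨v0, v1, v2, v3, v4, v5, v6, v7, v8, v9, v10, v11, v12, v13, v14, v15, v16, v17, v18, v19, v20, v21, v00⟩ :=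
    site_values L hL hΔ0 hΔ1 hf
  have hC := ShellRow.c0_shell_PQRT L hL3 hf.1 hf.2.1 (ground_mirror L hL2 hf) (ex L + ey L) (ex_add_ey_ne_zero L hL2) (fun h => hey0 (by simpa using h))
  rw [hC]
  unfold Dgrad xiW zetaW N41E.Pxy
  norm_num only [← hx, ← hy, ← B1.toTor_add, ← B1.toTor_neg, ← toTor_sub, Prod.neg_mk, Prod.mk_add_mk, Prod.mk_sub_mk]
  norm_num only [v0, v1, v2, v3, v4, v5, v6, v7, v8, v9, v10, v11, v12, v13, v14, v15, v16, v17, v18, v19, v20, v21, v00]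
  ring

/-- the window configuration `b = x̂−ŷ` in cancelled form: `C0(x̂, b) = Pxy(a, u₁₀, u₁₁, u₂₀, u₂₁)`
(`c0_shell_PQRT` + `site_values` + `ring`). [folklore] -/
theorem c0_win_xmy_eq (hL : 128 ≤ L) {Δ lam2 : ℝ} {f : Tor L → ℝ} (hΔ0 : 0 ≤ Δ) (hΔ1 : Δ < 1)
    (hf : IsGroundTwoMagnon L Δ lam2 f) :
    C0fn L Δ lam2 f (ex L, ex L - ey L) = N41E.Pxy (Δ * f (K1 L)) (cS L Δ lam2 f * aKer L lam2 (B1.toTor L ((1 : ℤ), (0 : ℤ)))) (cS L Δ lam2 f * aKer L lam2 (B1.toTor L ((1 : ℤ), (1 : ℤ)))) (cS L Δ lam2 f * aKer L lam2 (B1.toTor L ((2 : ℤ), (0 : ℤ)))) (cS L Δ lam2 f * aKer L lam2 (B1.toTor L ((2 : ℤ), (1 : ℤ)))) := by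
  have hL2 : 2 ≤ L := by omega
  have hL3 : 3 ≤ L := by omega
  obtain ⟨hx, hy, hK⟩ := ex_ey_toTor L
  have hnd := ShellRow.nn_distinct L hL3
  have hex0 : ex L ≠ 0 := hnd.1
  have hey0 : ey L ≠ 0 := by
    rw [← hy]; exact toTor_ne_zero_snd L one_ne_zero (by simp only [abs_one]; exact_mod_cast (show 1 < L by omega))
  have hxmy0 : ex L - ey L ≠ 0 := by
    have e : ex L - ey L = B1.toTor L ((1 : ℤ), (-1 : ℤ)) := by unfold B1.toTor ex ey; ext <;> simp
    rw [e]
    exact toTor_ne_zero_snd L (by norm_num) (by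
      simp only [abs_neg, abs_one]; exact_mod_cast (show 1 < L by omega))
  obtain ⟨v0, v1, v2, v3, v4, v5, v6, v7, v8, v9, v10, v11, v12, v13, v14, v15, v16, v17, v18, v19, v20, v21, v00⟩ :=
    site_values L hL hΔ0 hΔ1 hf
  have hC := ShellRow.c0_shell_PQRT L hL3 hf.1 hf.2.1 (ground_mirror L hL2 hf) (ex L - ey L) hxmy0 (fun h => hey0 (by simpa using h))
  rw [hC]
  unfold Dgrad xiW zetaW N41E.Pxy
  norm_num only [← hx, ← hy, ← B1.toTor_add, ← B1.toTor_neg, ← toTor_sub, Prod.neg_mk, Prod.mk_add_mk, Prod.mk_sub_mk]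
  norm_num only [v0, v1, v2, v3, v4, v5, v6, v7, v8, v9, v10, v11, v12, v13, v14, v15, v16, v17, v18, v19, v20, v21, v00]
  ring

/-- the window configuration `b = ŷ` in cancelled form: `C0(x̂, b) = Pxy(a, u₁₀, u₁₁, u₂₀, u₂₁)`
(`c0_shell_PQRT` + `site_values` + `ring`). [folklore] -/
theorem c0_win_ey_eq (hL : 128 ≤ L) {Δ lam2 : ℝ} {f : Tor L → ℝ} (hΔ0 : 0 ≤ Δ) (hΔ1 : Δ < 1)
    (hf : IsGroundTwoMagnon L Δ lam2 f) :
    C0fn L Δ lam2 f (ex L, ey L) = N41E.Pxy (Δ * f (K1 L)) (cS L Δ lam2 f * aKer L lam2 (B1.toTor L ((1 : ℤ), (0 : ℤ)))) (cS L Δ lam2 f * aKer L lam2 (B1.toTor L ((1 : ℤ), (1 : ℤ)))) (cS L Δ lam2 f * aKer L lam2 (B1.toTor L ((2 : ℤ), (0 : ℤ)))) (cS L Δ lam2 f * aKer L lam2 (B1.toTor L ((2 : ℤ), (1 : ℤ)))) := by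
  have hL2 : 2 ≤ L := by omega
  have hL3 : 3 ≤ L := by omega
  obtain ⟨hx, hy, hK⟩ := ex_ey_toTor L
  have hnd := ShellRow.nn_distinct L hL3
  have hex0 : ex L ≠ 0 := hnd.1
  have hey0 : ey L ≠ 0 := by
    rw [← hy]; exact toTor_ne_zero_snd L one_ne_zero (by simp only [abs_one]; exact_mod_cast (show 1 < L by omega))
  have hxmy0 : ex L - ey L ≠ 0 := by
    have e : ex L - ey L = B1.toTor L ((1 : ℤ), (-1 : ℤ)) := by unfold B1.toTor ex ey; ext <;> simp
    rw [e]
    exact toTor_ne_zero_snd L (by norm_num) (by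
      simp only [abs_neg, abs_one]; exact_mod_cast (show 1 < L by omega))
  obtain ⟨v0, v1, v2, v3, v4, v5, v6, v7, v8, v9, v10, v11, v12, v13, v14, v15, v16, v17, v18, v19, v20, v21, v00⟩ :=
    site_values L hL hΔ0 hΔ1 hf
  have hC := ShellRow.c0_shell_PQRT L hL3 hf.1 hf.2.1 (ground_mirror L hL2 hf) (ey L) hey0 hnd.2.2.1
  rw [hC]
  unfold Dgrad xiW zetaW N41E.Pxy
  norm_num only [← hx, ← hy, ← B1.toTor_add, ← B1.toTor_neg, ← toTor_sub, Prod.neg_mk, Prod.mk_add_mk, Prod.mk_sub_mk]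
  norm_num only [v0, v1, v2, v3, v4, v5, v6, v7, v8, v9, v10, v11, v12, v13, v14, v15, v16, v17, v18, v19, v20, v21, v00]
  ring

/-- the window configuration `b = −ŷ` in cancelled form: `C0(x̂, b) = Pxy(a, u₁₀, u₁₁, u₂₀, u₂₁)`
(`c0_shell_PQRT` + `site_values` + `ring`). [folklore] -/
theorem c0_win_negy_eq (hL : 128 ≤ L) {Δ lam2 : ℝ} {f : Tor L → ℝ} (hΔ0 : 0 ≤ Δ) (hΔ1 : Δ < 1)
    (hf : IsGroundTwoMagnon L Δ lam2 f) :
    C0fn L Δ lam2 f (ex L, -ey L) = N41E.Pxy (Δ * f (K1 L)) (cS L Δ lam2 f * aKer L lam2 (B1.toTor L ((1 : ℤ), (0 : ℤ)))) (cS L Δ lam2 f * aKer L lam2 (B1.toTor L ((1 : ℤ), (1 : ℤ)))) (cS L Δ lam2 f * aKer L lam2 (B1.toTor L ((2 : ℤ), (0 : ℤ)))) (cS L Δ lam2 f * aKer L lam2 (B1.toTor L ((2 : ℤ), (1 : ℤ)))) := by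
  have hL2 : 2 ≤ L := by omega
  have hL3 : 3 ≤ L := by omega
  obtain ⟨hx, hy, hK⟩ := ex_ey_toTor L
  have hnd := ShellRow.nn_distinct L hL3
  have hex0 : ex L ≠ 0 := hnd.1
  have hey0 : ey L ≠ 0 := by
    rw [← hy]; exact toTor_ne_zero_snd L one_ne_zero (by simp only [abs_one]; exact_mod_cast (show 1 < L by omega))
  have hxmy0 : ex L - ey L ≠ 0 := by
    have e : ex L - ey L = B1.toTor L ((1 : ℤ), (-1 : ℤ)) := by unfold B1.toTor ex ey; ext <;> simp
    rw [e]
    exact toTor_ne_zero_snd L (by norm_num) (by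
      simp only [abs_neg, abs_one]; exact_mod_cast (show 1 < L by omega))
  obtain ⟨v0, v1, v2, v3, v4, v5, v6, v7, v8, v9, v10, v11, v12, v13, v14, v15, v16, v17, v18, v19, v20, v21, v00⟩ :=
    site_values L hL hΔ0 hΔ1 hf
  have hC := ShellRow.c0_shell_PQRT L hL3 hf.1 hf.2.1 (ground_mirror L hL2 hf) (-ey L) (neg_ne_zero.mpr hey0) hnd.2.2.2.1
  rw [hC]
  unfold Dgrad xiW zetaW N41E.Pxy
  norm_num only [← hx, ← hy, ← B1.toTor_add, ← B1.toTor_neg, ← toTor_sub, Prod.neg_mk, Prod.mk_add_mk, Prod.mk_sub_mk]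
  norm_num only [v0, v1, v2, v3, v4, v5, v6, v7, v8, v9, v10, v11, v12, v13, v14, v15, v16, v17, v18, v19, v20, v21, v00]
  ring

/-- ★ `C0WinXXForm L` holds. [folklore] -/
theorem c0WinXXForm_holds : N41E.C0WinXXForm L := fun hL _ _ _ hΔ0 hΔ1 hf => c0_win_xx_eq L hL hΔ0 hΔ1 hf

/-- ★ `C0WinXYForm L` holds. [folklore] -/
theorem c0WinXYForm_holds : N41E.C0WinXYForm L := fun hL _ _ _ hΔ0 hΔ1 hf => c0_win_xy_eq L hL hΔ0 hΔ1 hf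

/-- ★ `C0WinOrbits L` holds (each orbit site is literally the same cubic). [folklore] -/
theorem c0WinOrbits_holds : N41E.C0WinOrbits L := by
  intro hL Δ lam2 f hΔ0 hΔ1 hf
  refine ⟨?_, ?_, ?_, ?_⟩
  · rw [c0_win_negx_eq L hL hΔ0 hΔ1 hf, c0_win_xx_eq L hL hΔ0 hΔ1 hf]
  · rw [c0_win_ey_eq L hL hΔ0 hΔ1 hf, c0_win_xy_eq L hL hΔ0 hΔ1 hf]
  · rw [c0_win_negy_eq L hL hΔ0 hΔ1 hf, c0_win_xy_eq L hL hΔ0 hΔ1 hf]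
  · rw [c0_win_xmy_eq L hL hΔ0 hΔ1 hf, c0_win_xy_eq L hL hΔ0 hΔ1 hf]

/-! ## The sharp window-shell majorant -/

/-- `Σ_{insert a s} g ≤ g a + Σ_s g` for `g a ≥ 0` (whether or not `a ∈ s`). [folklore] -/
theorem sum_insert_le_add {α : Type*} [DecidableEq α] (s : Finset α) (a : α) (g : α → ℝ) (ha : 0 ≤ g a) :
    ∑ x ∈ insert a s, g x ≤ g a + ∑ x ∈ s, g x := by
  by_cases h : a ∈ s
  · rw [Finset.insert_eq_of_mem h]; linarith
  · rw [Finset.sum_insert h]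

/-- ★★ **`ShellWinSharp L` holds**: `Σ_{b ∈ shellWin} C0(x̂,b)² ≤ ZwS(c_s, a)` for `L ≥ 128` and every ground profile. [folklore] -/
theorem shellWinSharp_holds : N41E.ShellWinSharp L := by
  classical
  intro hL Δ lam2 f hΔ0 hΔ1 hf
  obtain ⟨hc0, ha0, hF, hgF, c10l, c10u, c11l, c11u, c20l, c20u, c21l, c21u, c30l, c30u⟩ := site_numbers L hL hΔ0 hΔ1 hf
  have hxx := N41E.pxxSharpLe_holds (Δ * f (K1 L)) (cS L Δ lam2 f) _ _ _ _ _ ha0 hc0 c10l c10u c11l c11u c20l c20u c21l c21u c30l c30u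
  have hxy := N41E.pxySharpLe_holds (Δ * f (K1 L)) (cS L Δ lam2 f) _ _ _ _ ha0 hc0 c10l c10u c11l c11u c20l c20u c21l c21u
  set Bx : ℝ := N41E.BxxN (cS L Δ lam2 f) (Δ * f (K1 L)) with hBx
  set By : ℝ := N41E.BxyN (cS L Δ lam2 f) (Δ * f (K1 L)) with hBy
  have e1 : C0fn L Δ lam2 f (ex L, -ex L) ^ 2 ≤ Bx ^ 2 :=
    ShellRow.sq_le_sq_of_abs_le (by rw [c0_win_negx_eq L hL hΔ0 hΔ1 hf]; exact hxx)
  have e2 : C0fn L Δ lam2 f (ex L, ey L) ^ 2 ≤ By ^ 2 :=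
    ShellRow.sq_le_sq_of_abs_le (by rw [c0_win_ey_eq L hL hΔ0 hΔ1 hf]; exact hxy)
  have e3 : C0fn L Δ lam2 f (ex L, -ey L) ^ 2 ≤ By ^ 2 :=
    ShellRow.sq_le_sq_of_abs_le (by rw [c0_win_negy_eq L hL hΔ0 hΔ1 hf]; exact hxy)
  have e4 : C0fn L Δ lam2 f (ex L, ex L + ex L) ^ 2 ≤ Bx ^ 2 :=
    ShellRow.sq_le_sq_of_abs_le (by rw [c0_win_xx_eq L hL hΔ0 hΔ1 hf]; exact hxx)
  have e5 : C0fn L Δ lam2 f (ex L, ex L + ey L) ^ 2 ≤ By ^ 2 :=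
    ShellRow.sq_le_sq_of_abs_le (by rw [c0_win_xy_eq L hL hΔ0 hΔ1 hf]; exact hxy)
  have e6 : C0fn L Δ lam2 f (ex L, ex L - ey L) ^ 2 ≤ By ^ 2 :=
    ShellRow.sq_le_sq_of_abs_le (by rw [c0_win_xmy_eq L hL hΔ0 hΔ1 hf]; exact hxy)
  set g : Tor L → ℝ := fun b => C0fn L Δ lam2 f (ex L, b) ^ 2 with hg
  have hg0 : ∀ b, 0 ≤ g b := fun b => sq_nonneg _
  unfold shellWin
  calc ∑ b ∈ ({-ex L, ey L, -ey L, ex L + ex L, ex L + ey L, ex L - ey L} : Finset (Tor L)), g b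
      ≤ g (-ex L) + (g (ey L) + (g (-ey L) + (g (ex L + ex L) + (g (ex L + ey L) + ∑ b ∈ ({ex L - ey L} : Finset (Tor L)), g b)))) := by
        refine (sum_insert_le_add _ _ g (hg0 _)).trans (add_le_add le_rfl ?_)
        refine (sum_insert_le_add _ _ g (hg0 _)).trans (add_le_add le_rfl ?_)
        refine (sum_insert_le_add _ _ g (hg0 _)).trans (add_le_add le_rfl ?_)
        refine (sum_insert_le_add _ _ g (hg0 _)).trans (add_le_add le_rfl ?_)
        exact (sum_insert_le_add _ _ g (hg0 _)).trans (add_le_add le_rfl le_rfl)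
    _ = g (-ex L) + g (ey L) + g (-ey L) + g (ex L + ex L) + g (ex L + ey L) + g (ex L - ey L) := by
        rw [Finset.sum_singleton]; ring
    _ ≤ Bx ^ 2 + By ^ 2 + By ^ 2 + Bx ^ 2 + By ^ 2 + By ^ 2 := by
        simp only [hg]; linarith [e1, e2, e3, e4, e5, e6]
    _ = N41E.ZwS (cS L Δ lam2 f) (Δ * f (K1 L)) := by rw [hBx, hBy]; unfold N41E.ZwS; ring

/-- ★★ **`ShellWinSharpN L` holds** — the cell-variable form (the `hZ` of the sharp row-C cell soundness). [folklore] -/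
theorem shellWinSharpN_holds : N41E.ShellWinSharpN L := by
  intro hL Δ lam2 f hΔ0 hΔ1 hf
  have h := shellWinSharp_holds L hL Δ lam2 f hΔ0 hΔ1 hf
  obtain ⟨_, hcs, _, _⟩ := dict_N hL hΔ0 hΔ1 hf
  unfold N41E.ZwSN
  rw [← hcs]
  exact h

end RowC

end Summit.HubbardSuperconductivity.HubbardSuperconductivity.Theorems.AnisotropyChord.Transfer.Fibre3

end
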